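import Summits.CriticalPhenomena.CardyFormulaZ2.Theorems.CardyComplexConeEdgePrecompactHalfPlaneArmPrelim
import Summits.CriticalPhenomena.CardyFormulaZ2.Theorems.CardyComplexConeEdgePrecompactFluxBoundaryIdentity
import Summits.CriticalPhenomena.CardyFormulaZ2.Theorems.CardyComplexConeEdgePrecompactHalfBoxArmLeThreeSidedConn
import Summits.CriticalPhenomena.CardyFormulaZ2.Theorems.CardyComplexConeEdgePrecompactThreeSidedWallObs

/-!
# Necessity certificate, conclusion: `UniformInnerEnvelope` ⇒ cube-root half-plane one-arm bound
(line `qkz-strip-boundary-arm` of crux `CardyComplexCone.EdgePrecompact`, stmt-CriticalPhenomena-11387; lead c4;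
registered sub-goals `threeSided_fluxCoreEstimate` (core estimate) and the certificate's conclusion
`halfPlaneArm_cubeRoot_of_uniformInnerEnvelope`)

What this certifies. The line's open stub X1 (`stub_localInnerEnvelopeUI`, the local inner envelope at the
sharp exponent `1/3`) implies `UniformInnerEnvelope` (thinning, `…EdgePrecompactEnvelopeFromLocal.lean`), and
this file shows that `UniformInnerEnvelope` already forces the sharp (up-to-constants) cube-root UPPER bound
`P_{1/2}(half-plane one-arm to distance n) ≤ C' n^{-1/3}` for bond percolation on `ℤ²` — the upper half of
crux `HalfPlaneOneArmThird` (stmt-CriticalPhenomena-5662), whose exponent `1/3` is known on the triangular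
lattice only (Smirnov–Werner 2001) and is open on `ℤ²`. So any proof of X1 contains a proof of a sharp
boundary arm exponent bound for bond-`ℤ²`: X1 is at least that hard.

The argument (flux calibration at the free wall; Smirnov 2001 §2 / Duminil-Copin–Smirnov 2012 §8 contour
sums, in the tree's conventions). In the three-sided box `threeSided (6n) (3n)` (wired left, top, right;
free bottom row) sum the `q = 1` vertex relations of the corner observable (T1, landed; index form
`threeSided_vertexRelations`) over the face rectangle `[2n, 4n] × [0, n]` (`fluxBoundaryIdentity`, N2):
interior corners cancel, leaving the two wall families `Fc x 0 3`, `Fc x 0 2` and six interior side sums.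
By N6 (`threeSided_wallObs`) the wall corners carry the deterministic phases `1` and `e^{iπ/6}` times
passage probabilities, and the passage probability at `((x,0),3)` dominates the probability that `(x,0)` is
joined to the wired arc inside the box, which by N5 (`halfBoxArm_le_threeSided_conn`, RSW/FKG gluing) is
`≥ c · P(half-box arm at scale 2n)` uniformly in `x ∈ [2n,4n]`. Projecting the identity onto
`u = e^{-iπ/3}` (both wall phases project to `1/2`, the `i · Fc x 0 2` family included) gives
`n c P(arm 2n) ≤ Re(u · wall) ≤ ‖interior sides‖`, and the envelope at depth `y + 1` on the two columns
and `n + 1` on the top row (depths from `threeSided_infDist_compl`, N1) bounds the six sides by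
`(4 · 3/2 + 2 · 2) C n^{2/3}` (`∑_{y<n} (y+1)^{-1/3} ≤ 3/2 n^{2/3}`). Hence `P(arm 2n) ≤ (10 C / c) n^{-1/3}`;
odd and small scales follow by monotonicity in the scale and a change of constants.

References: S. Smirnov, C. R. Acad. Sci. Paris 333 (2001), §2; H. Duminil-Copin, S. Smirnov, arXiv:1109.1549,
§8; S. Smirnov, W. Werner, Math. Res. Lett. 8 (2001) (half-plane exponents on the triangular lattice);
P. Nolin, Electron. J. Probab. 13 (2008), §4.6.
-/

namespace Summit.CriticalPhenomena.CardyFormulaZ2.Cruxes.EdgePrecompact.QkzStripBoundaryArm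

open MeasureTheory Filter Set Metric
open scoped Topology BigOperators Pointwise
open Literature.Probability.LatticeModels Literature.Probability.Percolation
open Literature.Probability.RandomPlanarGeometry (DobrushinDomain)
open Summit.CriticalPhenomena.CardyFormulaZ2.Theses.CardyComplexCone
open LatticeDobrushin Finset

noncomputable section

/-! ## The core estimate at an even scale `2n` in the box `threeSided (6n) (3n)` -/

/-- **Core estimate (registered sub-goal `threeSided_fluxCoreEstimate`).** For `n ≥ 1`, given the envelope constant `C ≥ 0` (body of `UniformInnerEnvelope`),
the comparability constant `c` of N5 at scale `2n` and the wall evaluation N6 in the box `threeSided (6n) (3n)`: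
`c · n · P(half-box arm at scale 2n) ≤ 10 · C · n^{2/3}`. Proof: project the contour identity
`fluxBoundaryIdentity` (face rectangle `[2n, 4n] × [0, n]`) onto `u = e^{-iπ/3}`; the wall side is
`≥ ½ Σ_{x ∈ [2n,4n)} P(passage at ((x,0),3)) ≥ ½ · 2n · c · P(arm)`, the six interior sides have norm
`≤ (4 · 3/2 + 2 · 2) C n^{2/3}` by the envelope at depths `y + 1` (columns) and `n + 1` (top row). -/
theorem threeSided_fluxCoreEstimate {C c : ℝ} (hC0 : 0 ≤ C)
    (hUIE : ∀ (D : DobrushinDomain) (E : DiscreteDobrushin), E.Ω = D.carrier → E.IsZdAdmissible →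
      ∀ v f : Site 2, IsCorner v f → ∀ R : ℕ, 1 ≤ R →
      (R : ℝ) * E.δ ≤ infDist (meshPoint E.δ v) D.carrierᶜ →
      ‖cornerObs E E.δ v f‖ ≤ C * (R : ℝ) ^ (-(1:ℝ) / 3))
    (n : ℕ) (hn : 1 ≤ n)
    (h5 : ∀ x : ℕ, 2 * n ≤ x → x ≤ 4 * n →
      c * (bondPercolation (zdGraph 2) half).real {ω : BondConfig (Site 2) | ∃ y : Site 2,
        (y 0 = ((2 * n : ℕ) : ℤ) ∨ y 0 = -((2 * n : ℕ) : ℤ) ∨ y 1 = ((2 * n : ℕ) : ℤ)) ∧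
        ω ∈ openConnIn {v : Site 2 | 0 ≤ v 1 ∧ -((2 * n : ℕ) : ℤ) ≤ v 0 ∧ v 0 ≤ ((2 * n : ℕ) : ℤ) ∧
          v 1 ≤ ((2 * n : ℕ) : ℤ)} 0 y} ≤
      (bondPercolation (zdGraph 2) half).real {ω : BondConfig (Site 2) |
        ∃ a ∈ (LatticeDobrushin.threeSided (6 * n) (3 * n)).A,
          ω ∈ openConnIn {v : Site 2 | 0 ≤ v 0 ∧ v 0 ≤ ((6 * n : ℕ) : ℤ) ∧ 0 ≤ v 1 ∧ v 1 ≤ ((3 * n : ℕ) : ℤ)}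
            ![(x : ℤ), 0] a})
    (h6 : ∀ (hE : (LatticeDobrushin.threeSided (6 * n) (3 * n)).toDobrushin.IsZdAdmissible) (x : ℕ), 1 ≤ x →
      x + 1 ≤ 6 * n →
      cornerObs (LatticeDobrushin.threeSided (6 * n) (3 * n)).toDobrushin 1 ![(x : ℤ), 0] (faceAt ![(x : ℤ), 0] 3) =
          (((bondPercolation (zdGraph 2) half).real {ω : BondConfig (Site 2) |
            ∃ k < DiscreteDobrushin.exitTime hE ω,
              cornerOrbit ((LatticeDobrushin.threeSided (6 * n) (3 * n)).toDobrushin.bcBondConfig ω)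
                (DiscreteDobrushin.startCorner hE) k = (![(x : ℤ), 0], 3)} : ℝ) : ℂ) ∧
        cornerObs (LatticeDobrushin.threeSided (6 * n) (3 * n)).toDobrushin 1 ![(x : ℤ), 0] (faceAt ![(x : ℤ), 0] 2) =
          Complex.exp (Real.pi / 6 * Complex.I) *
            (((bondPercolation (zdGraph 2) half).real {ω : BondConfig (Site 2) |
              ∃ k < DiscreteDobrushin.exitTime hE ω,
                cornerOrbit ((LatticeDobrushin.threeSided (6 * n) (3 * n)).toDobrushin.bcBondConfig ω)
                  (DiscreteDobrushin.startCorner hE) k = (![(x : ℤ), 0], 2)} : ℝ) : ℂ) ∧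
        (bondPercolation (zdGraph 2) half).real {ω : BondConfig (Site 2) |
            ∃ k < DiscreteDobrushin.exitTime hE ω,
              cornerOrbit ((LatticeDobrushin.threeSided (6 * n) (3 * n)).toDobrushin.bcBondConfig ω)
                (DiscreteDobrushin.startCorner hE) k = (![(x : ℤ), 0], 2)} ≤
          (bondPercolation (zdGraph 2) half).real {ω : BondConfig (Site 2) |
            ∃ k < DiscreteDobrushin.exitTime hE ω,
              cornerOrbit ((LatticeDobrushin.threeSided (6 * n) (3 * n)).toDobrushin.bcBondConfig ω)
                (DiscreteDobrushin.startCorner hE) k = (![(x : ℤ), 0], 3)} ∧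
        (bondPercolation (zdGraph 2) half).real {ω : BondConfig (Site 2) |
            ∃ a ∈ (LatticeDobrushin.threeSided (6 * n) (3 * n)).A,
              ω ∈ openConnIn {v : Site 2 | 0 ≤ v 0 ∧ v 0 ≤ ((6 * n : ℕ) : ℤ) ∧ 0 ≤ v 1 ∧ v 1 ≤ ((3 * n : ℕ) : ℤ)}
                ![(x : ℤ), 0] a} ≤
          (bondPercolation (zdGraph 2) half).real {ω : BondConfig (Site 2) |
            ∃ k < DiscreteDobrushin.exitTime hE ω,
              cornerOrbit ((LatticeDobrushin.threeSided (6 * n) (3 * n)).toDobrushin.bcBondConfig ω)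
                (DiscreteDobrushin.startCorner hE) k = (![(x : ℤ), 0], 3)}) :
    c * n * (bondPercolation (zdGraph 2) half).real {ω : BondConfig (Site 2) | ∃ y : Site 2,
        (y 0 = ((2 * n : ℕ) : ℤ) ∨ y 0 = -((2 * n : ℕ) : ℤ) ∨ y 1 = ((2 * n : ℕ) : ℤ)) ∧
        ω ∈ openConnIn {v : Site 2 | 0 ≤ v 1 ∧ -((2 * n : ℕ) : ℤ) ≤ v 0 ∧ v 0 ≤ ((2 * n : ℕ) : ℤ) ∧
          v 1 ≤ ((2 * n : ℕ) : ℤ)} 0 y} ≤ 10 * C * (n : ℝ) ^ ((2:ℝ) / 3) := by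
  -- the box, its admissibility, its Jordan carrier
  set μ := bondPercolation (zdGraph 2) half with hμ
  set P : ℝ := μ.real {ω : BondConfig (Site 2) | ∃ y : Site 2,
        (y 0 = ((2 * n : ℕ) : ℤ) ∨ y 0 = -((2 * n : ℕ) : ℤ) ∨ y 1 = ((2 * n : ℕ) : ℤ)) ∧
        ω ∈ openConnIn {v : Site 2 | 0 ≤ v 1 ∧ -((2 * n : ℕ) : ℤ) ≤ v 0 ∧ v 0 ≤ ((2 * n : ℕ) : ℤ) ∧
          v 1 ≤ ((2 * n : ℕ) : ℤ)} 0 y} with hP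
  have hW : 1 ≤ 6 * n := by omega
  have hH : 1 ≤ 3 * n := by omega
  set L := LatticeDobrushin.threeSided (6 * n) (3 * n) with hL
  have hE : L.toDobrushin.IsZdAdmissible := isZdAdmissible_threeSided hW hH
  obtain ⟨D, hD⟩ := exists_dobrushinDomain_threeSided (6 * n) (3 * n)
  -- the corner table
  set Fc : ℤ → ℤ → Fin 4 → ℂ := fun x y k => cornerObs L.toDobrushin 1 ![x, y] (faceAt ![x, y] k) with hFc
  have hnR : (1 : ℝ) ≤ n := by exact_mod_cast hn
  have hn0 : (0 : ℝ) < n := by linarith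
  -- piece D: the envelope at a corner of given depth
  have env : ∀ (x y : ℤ) (k : Fin 4) (R : ℕ), 0 ≤ x → x ≤ 6 * n → -1 ≤ y → y ≤ 3 * n → 1 ≤ R →
      (R : ℝ) ≤ min (min ((x : ℝ) + 1 / 2) (((6 * n : ℕ) : ℝ) + 1 / 2 - x))
        (min ((y : ℝ) + 3 / 2) (((3 * n : ℕ) : ℝ) + 1 / 2 - y)) →
      ‖Fc x y k‖ ≤ C * (R : ℝ) ^ (-(1:ℝ) / 3) := by
    intro x y k R hx0 hxW hy0 hyH hR hRle
    have h := hUIE D L.toDobrushin hD.symm hE ![x, y] (faceAt ![x, y] k) (isCorner_faceAt _ _) R hR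
      (by
        rw [LatticeDobrushin.toDobrushin_δ, mul_one, hD]
        exact hRle.trans (threeSided_infDist_compl (6 * n) (3 * n) x y hx0 (by exact_mod_cast hxW) hy0
          (by exact_mod_cast hyH)))
    simpa only [LatticeDobrushin.toDobrushin_δ] using h
  -- columns `x = 2n` and `x = 4n`, heights `0 ≤ y < n`: depth `y + 1`
  have col : ∀ (x y : ℤ) (k : Fin 4), (x = 2 * n ∨ x = 4 * n) → 0 ≤ y → y < n →
      ‖Fc x y k‖ ≤ C * ((y : ℝ) + 1) ^ (-(1:ℝ) / 3) := by
    intro x y k hx hy0 hyn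
    obtain ⟨R, hR⟩ : ∃ R : ℕ, (R : ℤ) = y + 1 := ⟨(y + 1).toNat, Int.toNat_of_nonneg (by omega)⟩
    have hRr : (R : ℝ) = (y : ℝ) + 1 := by exact_mod_cast hR
    have h := env x y k R (by omega) (by omega) (by omega) (by omega) (by omega)
      (by
        rw [hRr]
        have h1 : (y : ℝ) + 1 ≤ n := by exact_mod_cast (show y + 1 ≤ (n : ℤ) by omega)
        have hy0' : (0 : ℝ) ≤ y := by exact_mod_cast hy0
        rcases hx with rfl | rfl <;> push_cast <;>
          refine le_min (le_min ?_ ?_) (le_min ?_ ?_) <;> linarith)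
    rwa [hRr] at h
  -- top row `y = n`, `2n < x < 4n`: depth `n + 1`, and `(n+1)^{-1/3} ≤ n^{-1/3}`
  have top : ∀ (x : ℤ) (k : Fin 4), 2 * n < x → x < 4 * n → ‖Fc x n k‖ ≤ C * (n : ℝ) ^ (-(1:ℝ) / 3) := by
    intro x k hx1 hx2
    have h := env x n k (n + 1) (by omega) (by omega) (by omega) (by omega) (by omega)
      (by
        have hx1' : 2 * (n : ℝ) + 1 ≤ x := by exact_mod_cast (show 2 * (n : ℤ) + 1 ≤ x by omega)
        have hx2' : (x : ℝ) + 1 ≤ 4 * n := by exact_mod_cast (show x + 1 ≤ 4 * (n : ℤ) by omega)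
        push_cast
        refine le_min (le_min ?_ ?_) (le_min ?_ ?_) <;> linarith)
    refine h.trans (mul_le_mul_of_nonneg_left ?_ hC0)
    exact rpow_neg_third_antitone hn0 (by push_cast; linarith)
  -- piece C: the vertex relations, and the contour identity over `[2n, 4n] × [0, n]`
  obtain ⟨hV, hHz⟩ := threeSided_vertexRelations (6 * n) (3 * n) hW hH
  have EQ := fluxBoundaryIdentity Fc (2 * n) (4 * n) n (by omega) (by omega)
    (fun x y h1 h2 h3 h4 => hV x y (by omega) (by omega) (by omega) (by omega))
    (fun x y h1 h2 h3 h4 => hHz x y (by omega) (by omega) (by omega) (by omega))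
  -- piece N6: the wall terms
  have wall : ∀ x : ℤ, 2 * n ≤ x → x ≤ 4 * n → ∃ p3 p2 : ℝ, Fc x 0 3 = (p3 : ℂ) ∧
      Fc x 0 2 = Complex.exp (Real.pi / 6 * Complex.I) * (p2 : ℂ) ∧ 0 ≤ p2 ∧ c * P ≤ p3 := by
    intro x hx1 hx2
    obtain ⟨m, rfl⟩ : ∃ m : ℕ, (m : ℤ) = x := ⟨x.toNat, Int.toNat_of_nonneg (by omega)⟩
    obtain ⟨e3, e2, _, hconn⟩ := h6 hE m (by omega) (by omega)
    refine ⟨_, _, e3, e2, measureReal_nonneg, ?_⟩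
    exact (h5 m (by omega) (by omega)).trans hconn
  -- the wall side of the identity, projected: `Re (u · wall) ≥ n c P`
  set W1 := ∑ x ∈ Finset.Ico (2 * (n : ℤ)) (4 * n), Fc x 0 3 with hW1
  set W2 := Complex.I * ∑ x ∈ Finset.Ioc (2 * (n : ℤ)) (4 * n), Fc x 0 2 with hW2
  have hre1 : (n : ℝ) * (c * P) ≤ ((Complex.mk (1 / 2) (-(Real.sqrt 3 / 2))) * W1).re := by
    rw [hW1, Finset.mul_sum, Complex.re_sum]
    have : ∀ x ∈ Finset.Ico (2 * (n : ℤ)) (4 * n), c * P / 2 ≤ ((Complex.mk (1 / 2) (-(Real.sqrt 3 / 2))) * Fc x 0 3).re := by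
      intro x hx
      rw [Finset.mem_Ico] at hx
      obtain ⟨p3, p2, e3, -, -, h3⟩ := wall x hx.1 hx.2.le
      rw [e3, re_uProj_mul_ofReal]; linarith
    refine le_trans ?_ (Finset.sum_le_sum this)
    rw [Finset.sum_const, Int.card_Ico, nsmul_eq_mul]
    have : ((4 * (n : ℤ) - 2 * n).toNat : ℝ) = 2 * n := by
      rw [show 4 * (n : ℤ) - 2 * n = ((2 * n : ℕ) : ℤ) by push_cast; ring, Int.toNat_natCast]; push_cast; ring
    rw [this]; linarith
  have hre2 : 0 ≤ ((Complex.mk (1 / 2) (-(Real.sqrt 3 / 2))) * W2).re := by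
    rw [hW2, Finset.mul_sum, Finset.mul_sum, Complex.re_sum]
    refine Finset.sum_nonneg fun x hx => ?_
    rw [Finset.mem_Ioc] at hx
    obtain ⟨p3, p2, -, e2, h2, -⟩ := wall x hx.1.le hx.2
    rw [e2, re_uProj_mul_I_exp]; linarith
  -- the interior sides
  set S1 := ∑ y ∈ Finset.Ico (0 : ℤ) n, Fc (2 * n) y 0 with hS1
  set S2 := ∑ y ∈ Finset.Ioo (0 : ℤ) n, Fc (2 * n) y 3 with hS2
  set S3 := ∑ x ∈ Finset.Ioo (2 * (n : ℤ)) (4 * n), Fc x n 2 with hS3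
  set S4 := ∑ x ∈ Finset.Ioo (2 * (n : ℤ)) (4 * n), Fc x n 3 with hS4
  set S5 := ∑ y ∈ Finset.Ico (0 : ℤ) n, Fc (4 * n) y 1 with hS5
  set S6 := ∑ y ∈ Finset.Ioo (0 : ℤ) n, Fc (4 * n) y 2 with hS6
  have hEQ : W1 + W2 = Complex.I * S1 - S2 + Complex.I * S3 + S4 + S5 - Complex.I * S6 := by
    linear_combination EQ
  have hsum := sum_Ico_int_rpow_neg_third_le n
  have colSum : ∀ (x : ℤ) (k : Fin 4), (x = 2 * n ∨ x = 4 * n) → ∀ s : Finset ℤ, s ⊆ Finset.Ico (0 : ℤ) n →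
      ‖∑ y ∈ s, Fc x y k‖ ≤ 3 / 2 * C * (n : ℝ) ^ ((2:ℝ) / 3) := by
    intro x k hx s hs
    calc ‖∑ y ∈ s, Fc x y k‖ ≤ ∑ y ∈ s, ‖Fc x y k‖ := norm_sum_le _ _
      _ ≤ ∑ y ∈ s, C * ((y : ℝ) + 1) ^ (-(1:ℝ) / 3) := Finset.sum_le_sum fun y hy => by
          have hy' := Finset.mem_Ico.1 (hs hy)
          exact col x y k hx hy'.1 hy'.2
      _ ≤ ∑ y ∈ Finset.Ico (0 : ℤ) n, C * ((y : ℝ) + 1) ^ (-(1:ℝ) / 3) :=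
          Finset.sum_le_sum_of_subset_of_nonneg hs fun y _ _ => by
            have : 0 ≤ ((y : ℝ) + 1) ^ (-(1:ℝ) / 3) := Real.rpow_nonneg (by
              have := Finset.mem_Ico.1 ‹y ∈ Finset.Ico (0:ℤ) n›
              exact_mod_cast (show (0:ℤ) ≤ y + 1 by omega)) _
            positivity
      _ = C * ∑ y ∈ Finset.Ico (0 : ℤ) n, ((y : ℝ) + 1) ^ (-(1:ℝ) / 3) := (Finset.mul_sum _ _ _).symm
      _ ≤ C * (3 / 2 * (n : ℝ) ^ ((2:ℝ) / 3)) := mul_le_mul_of_nonneg_left hsum hC0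
      _ = 3 / 2 * C * (n : ℝ) ^ ((2:ℝ) / 3) := by ring
  have topSum : ∀ k : Fin 4, ‖∑ x ∈ Finset.Ioo (2 * (n : ℤ)) (4 * n), Fc x n k‖ ≤ 2 * C * (n : ℝ) ^ ((2:ℝ) / 3) := by
    intro k
    calc ‖∑ x ∈ Finset.Ioo (2 * (n : ℤ)) (4 * n), Fc x n k‖
        ≤ ∑ x ∈ Finset.Ioo (2 * (n : ℤ)) (4 * n), ‖Fc x n k‖ := norm_sum_le _ _
      _ ≤ ∑ x ∈ Finset.Ioo (2 * (n : ℤ)) (4 * n), C * (n : ℝ) ^ (-(1:ℝ) / 3) :=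
          Finset.sum_le_sum fun x hx => by
            have hx' := Finset.mem_Ioo.1 hx
            exact top x k hx'.1 hx'.2
      _ = ((4 * (n : ℤ) - 2 * n - 1).toNat : ℝ) * (C * (n : ℝ) ^ (-(1:ℝ) / 3)) := by
          rw [Finset.sum_const, Int.card_Ioo, nsmul_eq_mul]
      _ ≤ (2 * n) * (C * (n : ℝ) ^ (-(1:ℝ) / 3)) := by
          refine mul_le_mul_of_nonneg_right ?_ (by positivity)
          have : ((4 * (n : ℤ) - 2 * n - 1).toNat : ℝ) = 2 * n - 1 := by
            have h' : 4 * (n : ℤ) - 2 * n - 1 = ((2 * n - 1 : ℕ) : ℤ) := by omega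
            rw [h', Int.toNat_natCast]
            rw [Nat.cast_sub (by omega)]; push_cast; ring
          rw [this]; linarith
      _ = 2 * C * ((n : ℝ) * (n : ℝ) ^ (-(1:ℝ) / 3)) := by ring
      _ = 2 * C * (n : ℝ) ^ ((2:ℝ) / 3) := by rw [mul_rpow_neg_third hn0]
  -- assemble
  have hI : ∀ z : ℂ, ‖Complex.I * z‖ = ‖z‖ := fun z => by rw [norm_mul, Complex.norm_I, one_mul]
  have key : ((Complex.mk (1 / 2) (-(Real.sqrt 3 / 2))) * (W1 + W2)).re ≤ 10 * C * (n : ℝ) ^ ((2:ℝ) / 3) := by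
    rw [hEQ]
    refine (re_uProj_mul_le_norm _).trans ?_
    calc ‖Complex.I * S1 - S2 + Complex.I * S3 + S4 + S5 - Complex.I * S6‖
        ≤ ‖Complex.I * S1‖ + ‖S2‖ + ‖Complex.I * S3‖ + ‖S4‖ + ‖S5‖ + ‖Complex.I * S6‖ := by
          have t1 := norm_sub_le (Complex.I * S1 - S2 + Complex.I * S3 + S4 + S5) (Complex.I * S6)
          have t2 := norm_add_le (Complex.I * S1 - S2 + Complex.I * S3 + S4) S5
          have t3 := norm_add_le (Complex.I * S1 - S2 + Complex.I * S3) S4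
          have t4 := norm_add_le (Complex.I * S1 - S2) (Complex.I * S3)
          have t5 := norm_sub_le (Complex.I * S1) S2
          linarith
      _ = ‖S1‖ + ‖S2‖ + ‖S3‖ + ‖S4‖ + ‖S5‖ + ‖S6‖ := by rw [hI, hI, hI]
      _ ≤ 3 / 2 * C * (n : ℝ) ^ ((2:ℝ) / 3) + 3 / 2 * C * (n : ℝ) ^ ((2:ℝ) / 3) +
            2 * C * (n : ℝ) ^ ((2:ℝ) / 3) + 2 * C * (n : ℝ) ^ ((2:ℝ) / 3) +
            3 / 2 * C * (n : ℝ) ^ ((2:ℝ) / 3) + 3 / 2 * C * (n : ℝ) ^ ((2:ℝ) / 3) := by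
          gcongr
          · exact colSum (2 * n) 0 (Or.inl rfl) _ subset_rfl
          · exact colSum (2 * n) 3 (Or.inl rfl) _ Finset.Ioo_subset_Ico_self
          · exact topSum 2
          · exact topSum 3
          · exact colSum (4 * n) 1 (Or.inr rfl) _ subset_rfl
          · exact colSum (4 * n) 2 (Or.inr rfl) _ Finset.Ioo_subset_Ico_self
      _ = 10 * C * (n : ℝ) ^ ((2:ℝ) / 3) := by ring
  have : ((Complex.mk (1 / 2) (-(Real.sqrt 3 / 2))) * (W1 + W2)).re = ((Complex.mk (1 / 2) (-(Real.sqrt 3 / 2))) * W1).re + ((Complex.mk (1 / 2) (-(Real.sqrt 3 / 2))) * W2).re := by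
    rw [mul_add, Complex.add_re]
  rw [this] at key
  calc c * n * P = (n : ℝ) * (c * P) := by ring
    _ ≤ ((Complex.mk (1 / 2) (-(Real.sqrt 3 / 2))) * W1).re + ((Complex.mk (1 / 2) (-(Real.sqrt 3 / 2))) * W2).re := by linarith
    _ ≤ 10 * C * (n : ℝ) ^ ((2:ℝ) / 3) := key

/-! ## The conclusion -/

/-- **Conclusion of the necessity certificate (registered sub-goal `halfPlaneArm_cubeRoot_of_uniformInnerEnvelope`).**
The uniform inner envelope `UniformInnerEnvelope` — hence the line's open stub X1 `stub_localInnerEnvelopeUI`, by the landed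
thinning lemma `uniformInnerEnvelope_of_localInnerEnvelopeUI` — forces the SHARP cube-root upper bound for the half-plane
one-arm probability of bond percolation on `ℤ²` at `p = 1/2`: `P_{1/2}(0 ↔ ∂([-n,n]×[0,n]) inside the half-box) ≤ C' n^{-1/3}`
for all `n ≥ 1` — the upper half of crux `HalfPlaneOneArmThird` (stmt-CriticalPhenomena-5662), an exponent not known
rigorously on `ℤ²`. Proof: the core estimate at even scales `2n ≥ 2 max(n₀,1)` (N5's threshold), division by `c n`,
monotonicity in the scale (`real_halfBoxArm_anti`) and `n^{-1/3} ≤ 3 m^{-1/3}` for `m ≤ 3n`; small scales are absorbed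
in the constant. -/
theorem halfPlaneArm_cubeRoot_of_uniformInnerEnvelope : UniformInnerEnvelope → ∃ C : ℝ, ∀ n : ℕ, 1 ≤ n → (bondPercolation (zdGraph 2) half).real {ω : BondConfig (Site 2) | ∃ y : Site 2, (y 0 = (n : ℤ) ∨ y 0 = -(n : ℤ) ∨ y 1 = (n : ℤ)) ∧ ω ∈ openConnIn {v : Site 2 | 0 ≤ v 1 ∧ -(n : ℤ) ≤ v 0 ∧ v 0 ≤ n ∧ v 1 ≤ n} 0 y} ≤ C * (n : ℝ) ^ (-(1 : ℝ) / 3) := by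
  intro hU
  obtain ⟨C, hC⟩ := hU
  obtain ⟨c, hc, n₀, h5⟩ := halfBoxArm_le_threeSided_conn
  set μ := bondPercolation (zdGraph 2) half with hμ
  -- a nonnegative envelope constant
  set C₀ := max C 0 with hC₀
  have hC₀0 : 0 ≤ C₀ := le_max_right _ _
  have hUIE : ∀ (D : DobrushinDomain) (E : DiscreteDobrushin), E.Ω = D.carrier → E.IsZdAdmissible →
      ∀ v f : Site 2, IsCorner v f → ∀ R : ℕ, 1 ≤ R →
      (R : ℝ) * E.δ ≤ infDist (meshPoint E.δ v) D.carrierᶜ →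
      ‖cornerObs E E.δ v f‖ ≤ C₀ * (R : ℝ) ^ (-(1:ℝ) / 3) :=
    fun D E hΩ hE v f hvf R hR hd =>
      (hC D E hΩ hE v f hvf R hR hd).trans
        (mul_le_mul_of_nonneg_right (le_max_left _ _) (Real.rpow_nonneg (Nat.cast_nonneg R) _))
  -- the bound at even scales `2n`, `n ≥ max n₀ 1`
  set K : ℝ := 10 * C₀ / c with hK
  have hK0 : 0 ≤ K := by positivity
  have even : ∀ n : ℕ, max n₀ 1 ≤ n →
      μ.real {ω : BondConfig (Site 2) | ∃ y : Site 2,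
        (y 0 = ((2 * n : ℕ) : ℤ) ∨ y 0 = -((2 * n : ℕ) : ℤ) ∨ y 1 = ((2 * n : ℕ) : ℤ)) ∧
        ω ∈ openConnIn {v : Site 2 | 0 ≤ v 1 ∧ -((2 * n : ℕ) : ℤ) ≤ v 0 ∧ v 0 ≤ ((2 * n : ℕ) : ℤ) ∧
          v 1 ≤ ((2 * n : ℕ) : ℤ)} 0 y} ≤ K * (n : ℝ) ^ (-(1:ℝ) / 3) := by
    intro n hn
    have hn1 : 1 ≤ n := le_trans (le_max_right _ _) hn
    have hn0 : (0 : ℝ) < n := by exact_mod_cast hn1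
    have hcore := threeSided_fluxCoreEstimate (c := c) hC₀0 hUIE n hn1 (h5 n (le_trans (le_max_left _ _) hn))
      (threeSided_wallObs (6 * n) (3 * n))
    rw [← hμ] at hcore
    -- divide by `c · n > 0`
    rw [hK, show 10 * C₀ / c * (n : ℝ) ^ (-(1:ℝ) / 3) = (10 * C₀ * (n : ℝ) ^ ((2:ℝ) / 3)) / (c * n) by
      rw [← rpow_two_thirds_div hn0]; field_simp]
    rw [le_div_iff₀ (by positivity)]
    linarith
  -- constants
  set M : ℕ := 2 * max n₀ 1 with hM
  have hM1 : (1 : ℝ) ≤ M := by rw [hM]; exact_mod_cast (show 1 ≤ 2 * max n₀ 1 by omega)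
  refine ⟨3 * K + M, fun m hm => ?_⟩
  have hm0 : (0 : ℝ) < m := by exact_mod_cast hm
  have hmr : 0 ≤ (m : ℝ) ^ (-(1:ℝ) / 3) := Real.rpow_nonneg hm0.le _
  rcases lt_or_ge m M with hlt | hge
  · -- small scales: the probability is at most `1 ≤ M · m^{-1/3}`
    have h1 : μ.real {ω : BondConfig (Site 2) | ∃ y : Site 2, (y 0 = (m : ℤ) ∨ y 0 = -(m : ℤ) ∨ y 1 = (m : ℤ)) ∧
        ω ∈ openConnIn {v : Site 2 | 0 ≤ v 1 ∧ -(m : ℤ) ≤ v 0 ∧ v 0 ≤ m ∧ v 1 ≤ m} 0 y} ≤ 1 :=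
      measureReal_le_one
    have h2 : (1 : ℝ) ≤ M * (m : ℝ) ^ (-(1:ℝ) / 3) := by
      have hmM : (m : ℝ) ≤ M := by exact_mod_cast hlt.le
      have h3 : (M : ℝ) ^ (-(1:ℝ) / 3) ≤ (m : ℝ) ^ (-(1:ℝ) / 3) := rpow_neg_third_antitone hm0 hmM
      have h4 : (1 : ℝ) ≤ (M : ℝ) * (M : ℝ) ^ (-(1:ℝ) / 3) := by
        rw [mul_rpow_neg_third (by linarith)]
        exact Real.one_le_rpow hM1 (by norm_num)
      nlinarith
    nlinarith
  · -- large scales: `n := m / 2 ≥ max n₀ 1`, `2n ≤ m ≤ 2n + 1 ≤ 3n`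
    set n := m / 2
    have hnge : max n₀ 1 ≤ n := by omega
    have hn1 : 1 ≤ n := le_trans (le_max_right _ _) hnge
    have h2n : 2 * n ≤ m := by omega
    have hm3n : m ≤ 3 * n := by omega
    have hmono := real_halfBoxArm_anti h2n
    have heven := even n hnge
    push_cast at hmono heven
    rw [← hμ] at hmono
    have hrp : (n : ℝ) ^ (-(1:ℝ) / 3) ≤ 3 * (m : ℝ) ^ (-(1:ℝ) / 3) :=
      rpow_neg_third_le_of_le_three_mul hm0 (by exact_mod_cast hm3n)
    calc _ ≤ _ := hmono
      _ ≤ K * (n : ℝ) ^ (-(1:ℝ) / 3) := heven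
      _ ≤ K * (3 * (m : ℝ) ^ (-(1:ℝ) / 3)) := mul_le_mul_of_nonneg_left hrp hK0
      _ ≤ (3 * K + M) * (m : ℝ) ^ (-(1:ℝ) / 3) := by nlinarith

end

end Summit.CriticalPhenomena.CardyFormulaZ2.Cruxes.EdgePrecompact.QkzStripBoundaryArm
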